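import Summits.CriticalPhenomena.PercolationContinuityZ3.Theorems.PercNearOneGluingNoHeavyLowerTailKnQuestion8CoefficientwiseGluing
import Summits.CriticalPhenomena.PercolationContinuityZ3.Theorems.PercNearOneGluingNoHeavyLowerTailDualBHKBlock
import HarnessLib

/-!
# THEOREM SP (b): the coefficientwise first rung is closed under SERIES composition

Support file (`--supports stmt-CriticalPhenomena-4575`, closed), prover `prim-lf-2` (gen 26).  No definitions, no named facts, no sorries; standard axioms.
Memo `prim-lf-2/CW-MARTINGALE-gen25.md` §8 (THEOREM SP and its proof), Lean bookkeeping `…CoefficientwiseGluing.lean`.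

The class `𝒞`.  For a finite multigraph `ends : ι → Sym2 V`, an edge set `E ⊆ ι` and two vertices `x, z`, say `(E; x, z) ∈ 𝒞` if for all monotone
`f, g : Set V → ℝ`
  `0 ≤ Σ_{s ⊆ E : z ∉ C_x(s), z ∉ C_x(E∖s)} (f(C_x s) − f(C_x(E∖s)))·(g(C_x s) − g(C_x(E∖s)))`,
where `C_x(s) = openCluster (ends '' s) x` is the red cluster of `x` for the colouring `s` (red) / `E ∖ s` (blue) of `E`, and the constraint says "no monochromatic
`x–z` path".  This is the coefficientwise (two-colouring) form CW-PA(z) of van den Berg–Häggström–Kahn's conditional positive association — the first rung of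
prim-lf-2's coefficientwise programme for Kozma–Nitzan's Question 8 (memo `CW-PROGRAMME-gen21.md`); it holds for pendant `z` (`Coefficientwise.cwpa_pendant_symm`).

* `Coefficientwise.cwpa_series` — **THEOREM SP (b)**: if `E₁, E₂` are disjoint edge sets whose edges can only share the vertex `v`, `x` meets no `E₂`-edge,
  `z ≠ x` meets no `E₁`-edge, and `(E₁; x, v) ∈ 𝒞`, `(E₂; v, z) ∈ 𝒞`, then `(E₁ ∪ E₂; x, z) ∈ 𝒞`.
* `Coefficientwise.cwpa_series_core` — the same with the hypothesis on `(E₁; x, v)` required only if some colouring of `E₂` joins `v` to `z` in both colours;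
  `Coefficientwise.cwpa_series_of_noDoublePath` — if none does (a single edge separates `v` from `z` inside `E₂`), `(E₂; v, z) ∈ 𝒞` alone suffices, for an
  arbitrary piece `E₁` (generalises gen 23's pendant-`z` theorem `cwpa_pendant_symm`).
Proof (memo §8).  A colouring of `E₁ ∪ E₂` is a pair `(s₁, s₂)`; the clusters glue as `K = K₁ ∪ [v∈K₁]K₂`, `K̄ = K̄₁ ∪ [v∈K̄₁]K̄₂`
(`mem_openCluster_union_glue`), and the wall is `¬(v∈K₁ ∧ z∈K₂) ∧ ¬(v∈K̄₁ ∧ z∈K̄₂)`.  Split by the `z`-side statistic `(z∈K₂, z∈K̄₂)`: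
`(1,1)` gives `T'(E₁;x,v)[f,g] ≥ 0` (hypothesis); `(1,0)` and `(0,1)` are the two-function off-cluster lemma `offCluster_twoColouring_nonneg₂_sub` (avoided set `{v}`,
blue-side function `W ↦ f(W ∪ [v∈W]K̄₂) ≥ f`); on `(0,0)` the summand is a product of two functions monotone in `s₁`, so FKG on `E₁.powerset` (`fkg_powerset`) and
the colour swap on `E₁` bound the block below by `2^{-|E₁|}·T'(E₂;v,z)[Ψf,Ψg]` with `Ψf(W) = Σ_{s₁} f(K₁ ∪ [v∈K₁]W)` monotone — nonnegative by the second hypothesis.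
[cite: KozmaNitzan2024, Questions 8–9 (§5.5 p. 36) (context: first rung of the coefficientwise programme for Question 8)]
-/

namespace Summit.CriticalPhenomena.PercolationContinuityZ3.Theorems

open Finset Literature.Probability.Percolation

namespace Coefficientwise

variable {ι V : Type*} [Fintype ι] [DecidableEq ι]

open Classical in
/-- **THEOREM SP (b) — series composition, core form** (memo `prim-lf-2/CW-MARTINGALE-gen25.md` §8).  Let `E₁, E₂ ⊆ ι` be disjoint edge sets of a
finite multigraph `ends : ι → Sym2 V` such that an `E₁`-edge and an `E₂`-edge can only share the vertex `v`; let `x` meet no `E₂`-edge and `z ≠ x` meet no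
`E₁`-edge.  If `(E₂; v, z)` satisfies the coefficientwise first rung, and `(E₁; x, v)` does whenever some colouring of `E₂` joins `v` to `z` in both colours
(the only case in which that hypothesis is used), then `(E₁ ∪ E₂; x, z)` satisfies it:
`0 ≤ Σ_{s ⊆ E₁∪E₂ : no monochromatic x–z path} (f(C_x s) − f(C_x(E∖s)))(g(C_x s) − g(C_x(E∖s)))` for all monotone `f, g`.
[cite: KozmaNitzan2024, Questions 8–9 (§5.5 p. 36) (context)] -/
theorem cwpa_series_core (ends : ι → Sym2 V) {E₁ E₂ : Finset ι} (hE : Disjoint E₁ E₂) {x v z : V}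
    (hsep : ∀ e ∈ E₁, ∀ e' ∈ E₂, ∀ w : V, w ∈ ends e → w ∈ ends e' → w = v)
    (hx : ∀ e ∈ E₂, x ∉ ends e) (hz : ∀ e ∈ E₁, z ∉ ends e) (hzx : z ≠ x)
    (h₁ : (∃ s₂, s₂ ⊆ E₂ ∧ z ∈ openCluster (ends '' (↑s₂ : Set ι)) v ∧ z ∈ openCluster (ends '' (↑(E₂ \ s₂) : Set ι)) v) →
      ∀ φ ψ : Set V → ℝ, Monotone φ → Monotone ψ →
      0 ≤ ∑ s ∈ E₁.powerset.filter (fun s : Finset ι => v ∉ openCluster (ends '' (↑s : Set ι)) x ∧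
            v ∉ openCluster (ends '' (↑(E₁ \ s) : Set ι)) x),
        (φ (openCluster (ends '' (↑s : Set ι)) x) - φ (openCluster (ends '' (↑(E₁ \ s) : Set ι)) x)) *
          (ψ (openCluster (ends '' (↑s : Set ι)) x) - ψ (openCluster (ends '' (↑(E₁ \ s) : Set ι)) x)))
    (h₂ : ∀ φ ψ : Set V → ℝ, Monotone φ → Monotone ψ →
      0 ≤ ∑ s ∈ E₂.powerset.filter (fun s : Finset ι => z ∉ openCluster (ends '' (↑s : Set ι)) v ∧
            z ∉ openCluster (ends '' (↑(E₂ \ s) : Set ι)) v),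
        (φ (openCluster (ends '' (↑s : Set ι)) v) - φ (openCluster (ends '' (↑(E₂ \ s) : Set ι)) v)) *
          (ψ (openCluster (ends '' (↑s : Set ι)) v) - ψ (openCluster (ends '' (↑(E₂ \ s) : Set ι)) v)))
    (f g : Set V → ℝ) (hf : Monotone f) (hg : Monotone g) :
    0 ≤ ∑ s ∈ (E₁ ∪ E₂).powerset.filter (fun s : Finset ι => z ∉ openCluster (ends '' (↑s : Set ι)) x ∧
          z ∉ openCluster (ends '' (↑((E₁ ∪ E₂) \ s) : Set ι)) x),
      (f (openCluster (ends '' (↑s : Set ι)) x) - f (openCluster (ends '' (↑((E₁ ∪ E₂) \ s) : Set ι)) x)) *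
        (g (openCluster (ends '' (↑s : Set ι)) x) - g (openCluster (ends '' (↑((E₁ ∪ E₂) \ s) : Set ι)) x)) := by
  -- notation: red clusters of `x` and of `v`, and the gluing operation at `v`
  set K : Finset ι → Set V := fun s => openCluster (ends '' (↑s : Set ι)) x with hK
  set Kv : Finset ι → Set V := fun s => openCluster (ends '' (↑s : Set ι)) v with hKv
  set gl : Set V → Set V → Set V := fun X W => X ∪ {y | v ∈ X ∧ y ∈ W} with hgl
  change 0 ≤ ∑ s ∈ (E₁ ∪ E₂).powerset.filter (fun s => z ∉ K s ∧ z ∉ K ((E₁ ∪ E₂) \ s)),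
      (f (K s) - f (K ((E₁ ∪ E₂) \ s))) * (g (K s) - g (K ((E₁ ∪ E₂) \ s)))
  have h₁' : (∃ s₂, s₂ ⊆ E₂ ∧ z ∈ Kv s₂ ∧ z ∈ Kv (E₂ \ s₂)) → ∀ φ ψ : Set V → ℝ, Monotone φ → Monotone ψ →
      0 ≤ ∑ s ∈ E₁.powerset.filter (fun s => v ∉ K s ∧ v ∉ K (E₁ \ s)),
        (φ (K s) - φ (K (E₁ \ s))) * (ψ (K s) - ψ (K (E₁ \ s))) := h₁
  have h₂' : ∀ φ ψ : Set V → ℝ, Monotone φ → Monotone ψ →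
      0 ≤ ∑ s ∈ E₂.powerset.filter (fun s => z ∉ Kv s ∧ z ∉ Kv (E₂ \ s)),
        (φ (Kv s) - φ (Kv (E₂ \ s))) * (ψ (Kv s) - ψ (Kv (E₂ \ s))) := h₂
  -- basic facts
  have hKmono : ∀ {s t : Finset ι}, s ⊆ t → K s ⊆ K t := fun hst => openCluster_image_mono ends hst x
  have mem_gl : ∀ (X W : Set V) (y : V), y ∈ gl X W ↔ y ∈ X ∨ (v ∈ X ∧ y ∈ W) := fun X W y => by
    simp only [hgl, Set.mem_union, Set.mem_setOf_eq]
  have gl_of_not : ∀ X W : Set V, v ∉ X → gl X W = X := by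
    intro X W hv; ext y; rw [mem_gl]; tauto
  have gl_mono_left : ∀ {X X' : Set V} (W : Set V), X ⊆ X' → gl X W ⊆ gl X' W := by
    intro X X' W h y hy
    rw [mem_gl] at hy ⊢
    rcases hy with hy | ⟨hv, hy⟩
    · exact Or.inl (h hy)
    · exact Or.inr ⟨h hv, hy⟩
  have gl_mono_right : ∀ (X : Set V) {W W' : Set V}, W ⊆ W' → gl X W ⊆ gl X W' := by
    intro X W W' h y hy
    rw [mem_gl] at hy ⊢
    rcases hy with hy | ⟨hv, hy⟩
    · exact Or.inl hy
    · exact Or.inr ⟨hv, h hy⟩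
  have le_gl : ∀ X W : Set V, X ⊆ gl X W := fun X W y hy => by rw [mem_gl]; exact Or.inl hy
  have hzK : ∀ s₁ : Finset ι, s₁ ⊆ E₁ → z ∉ K s₁ := fun s₁ hs₁ =>
    not_mem_openCluster_of_forall_not_mem ends (fun e he => hz e (hs₁ he)) hzx
  have not_mem_gl : ∀ (X W : Set V), z ∉ X → (z ∉ gl X W ↔ ¬(v ∈ X ∧ z ∈ W)) := by
    intro X W hzX; rw [mem_gl]; tauto
  -- cluster decomposition under gluing at `v`
  have decomp : ∀ s₁ s₂ : Finset ι, s₁ ⊆ E₁ → s₂ ⊆ E₂ → K (s₁ ∪ s₂) = gl (K s₁) (Kv s₂) := by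
    intro s₁ s₂ hs₁ hs₂
    ext y
    rw [mem_gl]
    exact mem_openCluster_union_glue ends (fun e he e' he' w hw hw' => hsep e (hs₁ he) e' (hs₂ he') w hw hw')
      (fun e he hxe => absurd hxe (hx e (hs₂ he))) y
  -- the sum over colourings of `E₁ ∪ E₂` as a double sum, each summand in glued form
  simp only [Finset.sum_filter]
  rw [DualBHK.sum_powerset_union hE, Finset.sum_comm]
  have hsummand : ∀ s₂ ∈ E₂.powerset, ∀ s₁ ∈ E₁.powerset,
      (if z ∉ K (s₁ ∪ s₂) ∧ z ∉ K ((E₁ ∪ E₂) \ (s₁ ∪ s₂))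
        then (f (K (s₁ ∪ s₂)) - f (K ((E₁ ∪ E₂) \ (s₁ ∪ s₂)))) *
          (g (K (s₁ ∪ s₂)) - g (K ((E₁ ∪ E₂) \ (s₁ ∪ s₂)))) else 0)
      = (if ¬(v ∈ K s₁ ∧ z ∈ Kv s₂) ∧ ¬(v ∈ K (E₁ \ s₁) ∧ z ∈ Kv (E₂ \ s₂))
        then (f (gl (K s₁) (Kv s₂)) - f (gl (K (E₁ \ s₁)) (Kv (E₂ \ s₂)))) *
          (g (gl (K s₁) (Kv s₂)) - g (gl (K (E₁ \ s₁)) (Kv (E₂ \ s₂)))) else 0) := by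
    intro s₂ hs₂ s₁ hs₁
    have hs₁' := Finset.mem_powerset.mp hs₁
    have hs₂' := Finset.mem_powerset.mp hs₂
    have hK12 : K (s₁ ∪ s₂) = gl (K s₁) (Kv s₂) := decomp s₁ s₂ hs₁' hs₂'
    have hKc : K ((E₁ ∪ E₂) \ (s₁ ∪ s₂)) = gl (K (E₁ \ s₁)) (Kv (E₂ \ s₂)) := by
      rw [union_sdiff_union_of_subset hE hs₁' hs₂']
      exact decomp (E₁ \ s₁) (E₂ \ s₂) Finset.sdiff_subset Finset.sdiff_subset
    have hcond : (z ∉ K (s₁ ∪ s₂) ∧ z ∉ K ((E₁ ∪ E₂) \ (s₁ ∪ s₂))) ↔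
        (¬(v ∈ K s₁ ∧ z ∈ Kv s₂) ∧ ¬(v ∈ K (E₁ \ s₁) ∧ z ∈ Kv (E₂ \ s₂))) := by
      rw [hK12, hKc]
      exact and_congr (not_mem_gl _ _ (hzK s₁ hs₁')) (not_mem_gl _ _ (hzK _ Finset.sdiff_subset))
    by_cases hc : z ∉ K (s₁ ∪ s₂) ∧ z ∉ K ((E₁ ∪ E₂) \ (s₁ ∪ s₂))
    · rw [if_pos hc, if_pos (hcond.mp hc), hK12, hKc]
    · rw [if_neg hc, if_neg (fun h => hc (hcond.mpr h))]
  rw [Finset.sum_congr rfl fun s₂ hs₂ => Finset.sum_congr rfl fun s₁ hs₁ => hsummand s₂ hs₂ s₁ hs₁]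
  -- the inner sum, as a function of the colouring `s₂` of `E₂`
  set I : Finset ι → ℝ := fun s₂ => ∑ s₁ ∈ E₁.powerset,
      (if ¬(v ∈ K s₁ ∧ z ∈ Kv s₂) ∧ ¬(v ∈ K (E₁ \ s₁) ∧ z ∈ Kv (E₂ \ s₂))
        then (f (gl (K s₁) (Kv s₂)) - f (gl (K (E₁ \ s₁)) (Kv (E₂ \ s₂)))) *
          (g (gl (K s₁) (Kv s₂)) - g (gl (K (E₁ \ s₁)) (Kv (E₂ \ s₂)))) else 0) with hI
  -- block (1,1): the first hypothesis
  have blockA : ∀ s₂, s₂ ⊆ E₂ → z ∈ Kv s₂ → z ∈ Kv (E₂ \ s₂) →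
      0 ≤ ∑ s₁ ∈ E₁.powerset, (if v ∉ K s₁ ∧ v ∉ K (E₁ \ s₁)
      then (f (K s₁) - f (K (E₁ \ s₁))) * (g (K s₁) - g (K (E₁ \ s₁))) else 0) := by
    intro s₂ hs₂ hz1 hz2
    have := h₁' ⟨s₂, hs₂, hz1, hz2⟩ f g hf hg
    rw [Finset.sum_filter] at this
    exact this
  -- block (1,0): the two-function off-cluster lemma with avoided set `{v}`
  have blockB : ∀ W : Set V, 0 ≤ ∑ s₁ ∈ E₁.powerset, (if v ∉ K s₁
      then (f (K s₁) - f (gl (K (E₁ \ s₁)) W)) * (g (K s₁) - g (gl (K (E₁ \ s₁)) W)) else 0) := by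
    intro W
    have key := offCluster_twoColouring_nonneg₂_sub ends E₁ x ({v} : Set V) f (fun X => f (gl X W)) g (fun X => g (gl X W))
      hf (fun X X' h => hf (gl_mono_left W h)) hg (fun X X' h => hg (gl_mono_left W h))
      (fun X => hf (le_gl X W)) (fun X => hg (le_gl X W))
    rw [Finset.sum_filter] at key
    refine key.trans_eq (Finset.sum_congr rfl fun s₁ _ => ?_)
    refine if_congr ⟨fun h => h v rfl, fun h a ha => ?_⟩ rfl rfl
    rw [Set.mem_singleton_iff] at ha
    rw [ha]; exact h
  -- block (0,1): the colour swap on `E₁` turns it into block (1,0)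
  have blockC : ∀ W : Set V, 0 ≤ ∑ s₁ ∈ E₁.powerset, (if v ∉ K (E₁ \ s₁)
      then (f (gl (K s₁) W) - f (K (E₁ \ s₁))) * (g (gl (K s₁) W) - g (K (E₁ \ s₁))) else 0) := by
    intro W
    have e : ∑ s₁ ∈ E₁.powerset, (if v ∉ K (E₁ \ s₁)
        then (f (K (E₁ \ s₁)) - f (gl (K (E₁ \ (E₁ \ s₁))) W)) * (g (K (E₁ \ s₁)) - g (gl (K (E₁ \ (E₁ \ s₁))) W)) else 0)
        = ∑ s₁ ∈ E₁.powerset, (if v ∉ K s₁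
          then (f (K s₁) - f (gl (K (E₁ \ s₁)) W)) * (g (K s₁) - g (gl (K (E₁ \ s₁)) W)) else 0) :=
      sum_powerset_sdiff E₁ (fun t => if v ∉ K t
        then (f (K t) - f (gl (K (E₁ \ t)) W)) * (g (K t) - g (gl (K (E₁ \ t)) W)) else 0)
    have key := blockB W
    rw [← e] at key
    refine key.trans_eq (Finset.sum_congr rfl fun s₁ hs₁ => ?_)
    rw [Finset.sdiff_sdiff_eq_self (Finset.mem_powerset.mp hs₁)]
    refine if_congr Iff.rfl ?_ rfl
    ring
  -- block (0,0): FKG on the colourings of `E₁` and the swap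
  set Ψf : Set V → ℝ := fun W => ∑ s₁ ∈ E₁.powerset, f (gl (K s₁) W) with hΨf
  set Ψg : Set V → ℝ := fun W => ∑ s₁ ∈ E₁.powerset, g (gl (K s₁) W) with hΨg
  have hΨf_mono : Monotone Ψf := fun W W' h => Finset.sum_le_sum fun s₁ _ => hf (gl_mono_right _ h)
  have hΨg_mono : Monotone Ψg := fun W W' h => Finset.sum_le_sum fun s₁ _ => hg (gl_mono_right _ h)
  have sumFf : ∀ W W' : Set V,
      ∑ s₁ ∈ E₁.powerset, (f (gl (K s₁) W) - f (gl (K (E₁ \ s₁)) W')) = Ψf W - Ψf W' := by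
    intro W W'
    have e : ∑ s₁ ∈ E₁.powerset, f (gl (K (E₁ \ s₁)) W') = ∑ s₁ ∈ E₁.powerset, f (gl (K s₁) W') :=
      sum_powerset_sdiff E₁ (fun t => f (gl (K t) W'))
    rw [Finset.sum_sub_distrib, e]
  have sumFg : ∀ W W' : Set V,
      ∑ s₁ ∈ E₁.powerset, (g (gl (K s₁) W) - g (gl (K (E₁ \ s₁)) W')) = Ψg W - Ψg W' := by
    intro W W'
    have e : ∑ s₁ ∈ E₁.powerset, g (gl (K (E₁ \ s₁)) W') = ∑ s₁ ∈ E₁.powerset, g (gl (K s₁) W') :=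
      sum_powerset_sdiff E₁ (fun t => g (gl (K t) W'))
    rw [Finset.sum_sub_distrib, e]
  have blockD : ∀ W W' : Set V,
      (∑ s₁ ∈ E₁.powerset, (f (gl (K s₁) W) - f (gl (K (E₁ \ s₁)) W'))) *
        (∑ s₁ ∈ E₁.powerset, (g (gl (K s₁) W) - g (gl (K (E₁ \ s₁)) W'))) ≤
      (2 ^ E₁.card : ℝ) * ∑ s₁ ∈ E₁.powerset,
        (f (gl (K s₁) W) - f (gl (K (E₁ \ s₁)) W')) * (g (gl (K s₁) W) - g (gl (K (E₁ \ s₁)) W')) := by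
    intro W W'
    set F : Finset ι → ℝ := fun t => f (gl (K (t ∩ E₁)) W) - f (gl (K (E₁ \ t)) W') with hF
    set G : Finset ι → ℝ := fun t => g (gl (K (t ∩ E₁)) W) - g (gl (K (E₁ \ t)) W') with hG
    have hFm : Monotone F := by
      intro a b hab
      simp only [hF]
      have h1 : f (gl (K (a ∩ E₁)) W) ≤ f (gl (K (b ∩ E₁)) W) :=
        hf (gl_mono_left W (hKmono (Finset.inter_subset_inter_right hab)))
      have h2 : f (gl (K (E₁ \ b)) W') ≤ f (gl (K (E₁ \ a)) W') :=
        hf (gl_mono_left W' (hKmono (Finset.sdiff_subset_sdiff (le_refl E₁) hab)))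
      linarith
    have hGm : Monotone G := by
      intro a b hab
      simp only [hG]
      have h1 : g (gl (K (a ∩ E₁)) W) ≤ g (gl (K (b ∩ E₁)) W) :=
        hg (gl_mono_left W (hKmono (Finset.inter_subset_inter_right hab)))
      have h2 : g (gl (K (E₁ \ b)) W') ≤ g (gl (K (E₁ \ a)) W') :=
        hg (gl_mono_left W' (hKmono (Finset.sdiff_subset_sdiff (le_refl E₁) hab)))
      linarith
    have key := fkg_powerset E₁ F G hFm hGm
    have hFE : ∀ t ∈ E₁.powerset, F t = f (gl (K t) W) - f (gl (K (E₁ \ t)) W') := fun t ht => by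
      simp only [hF, Finset.inter_eq_left.mpr (Finset.mem_powerset.mp ht)]
    have hGE : ∀ t ∈ E₁.powerset, G t = g (gl (K t) W) - g (gl (K (E₁ \ t)) W') := fun t ht => by
      simp only [hG, Finset.inter_eq_left.mpr (Finset.mem_powerset.mp ht)]
    have e1 : ∑ t ∈ E₁.powerset, F t = ∑ t ∈ E₁.powerset, (f (gl (K t) W) - f (gl (K (E₁ \ t)) W')) :=
      Finset.sum_congr rfl hFE
    have e2 : ∑ t ∈ E₁.powerset, G t = ∑ t ∈ E₁.powerset, (g (gl (K t) W) - g (gl (K (E₁ \ t)) W')) :=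
      Finset.sum_congr rfl hGE
    have e3 : ∑ t ∈ E₁.powerset, F t * G t = ∑ t ∈ E₁.powerset,
        (f (gl (K t) W) - f (gl (K (E₁ \ t)) W')) * (g (gl (K t) W) - g (gl (K (E₁ \ t)) W')) :=
      Finset.sum_congr rfl fun t ht => by rw [hFE t ht, hGE t ht]
    rw [e1, e2, e3] at key
    exact key
  -- split the outer sum by the `z`-side statistic `(z ∈ K₂, z ∈ K̄₂)`
  rw [← Finset.sum_filter_add_sum_filter_not E₂.powerset (fun s₂ => z ∉ Kv s₂ ∧ z ∉ Kv (E₂ \ s₂)) I]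
  apply add_nonneg
  · -- block (0,0), summed over `s₂` with no monochromatic `v–z` path in `E₂`
    have hterm : ∀ s₂ ∈ E₂.powerset.filter (fun s₂ => z ∉ Kv s₂ ∧ z ∉ Kv (E₂ \ s₂)),
        (Ψf (Kv s₂) - Ψf (Kv (E₂ \ s₂))) * (Ψg (Kv s₂) - Ψg (Kv (E₂ \ s₂))) ≤ (2 ^ E₁.card : ℝ) * I s₂ := by
      intro s₂ hs₂
      obtain ⟨_, hz1, hz2⟩ := Finset.mem_filter.mp hs₂
      have hIs : I s₂ = ∑ s₁ ∈ E₁.powerset, (f (gl (K s₁) (Kv s₂)) - f (gl (K (E₁ \ s₁)) (Kv (E₂ \ s₂)))) *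
          (g (gl (K s₁) (Kv s₂)) - g (gl (K (E₁ \ s₁)) (Kv (E₂ \ s₂)))) := by
        simp only [hI]
        refine Finset.sum_congr rfl fun s₁ _ => ?_
        rw [if_pos ⟨fun h => hz1 h.2, fun h => hz2 h.2⟩]
      rw [hIs, ← sumFf, ← sumFg]
      exact blockD _ _
    have hsum : ∑ s₂ ∈ E₂.powerset.filter (fun s₂ => z ∉ Kv s₂ ∧ z ∉ Kv (E₂ \ s₂)),
          (Ψf (Kv s₂) - Ψf (Kv (E₂ \ s₂))) * (Ψg (Kv s₂) - Ψg (Kv (E₂ \ s₂))) ≤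
        (2 ^ E₁.card : ℝ) * ∑ s₂ ∈ E₂.powerset.filter (fun s₂ => z ∉ Kv s₂ ∧ z ∉ Kv (E₂ \ s₂)), I s₂ := by
      rw [Finset.mul_sum]
      exact Finset.sum_le_sum hterm
    have h0 := h₂' Ψf Ψg hΨf_mono hΨg_mono
    have hpos : (0 : ℝ) < (2 ^ E₁.card : ℝ) := by positivity
    exact (mul_nonneg_iff_of_pos_left hpos).mp (h0.trans hsum)
  · -- blocks (1,1), (1,0), (0,1): each inner sum is nonnegative
    refine Finset.sum_nonneg fun s₂ hs₂ => ?_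
    obtain ⟨hs₂E, hnot⟩ := Finset.mem_filter.mp hs₂
    by_cases hz1 : z ∈ Kv s₂ <;> by_cases hz2 : z ∈ Kv (E₂ \ s₂)
    · -- (1,1)
      have hIs : I s₂ = ∑ s₁ ∈ E₁.powerset, (if v ∉ K s₁ ∧ v ∉ K (E₁ \ s₁)
          then (f (K s₁) - f (K (E₁ \ s₁))) * (g (K s₁) - g (K (E₁ \ s₁))) else 0) := by
        simp only [hI]
        refine Finset.sum_congr rfl fun s₁ _ => ?_
        by_cases h1 : v ∈ K s₁ <;> by_cases h2 : v ∈ K (E₁ \ s₁)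
        · rw [if_neg (fun h => h.1 ⟨h1, hz1⟩), if_neg (fun h => h.1 h1)]
        · rw [if_neg (fun h => h.1 ⟨h1, hz1⟩), if_neg (fun h => h.1 h1)]
        · rw [if_neg (fun h => h.2 ⟨h2, hz2⟩), if_neg (fun h => h.2 h2)]
        · rw [if_pos ⟨fun h => h1 h.1, fun h => h2 h.1⟩, if_pos ⟨h1, h2⟩, gl_of_not _ _ h1, gl_of_not _ _ h2]
      rw [hIs]; exact blockA s₂ (Finset.mem_powerset.mp hs₂E) hz1 hz2
    · -- (1,0)
      have hIs : I s₂ = ∑ s₁ ∈ E₁.powerset, (if v ∉ K s₁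
          then (f (K s₁) - f (gl (K (E₁ \ s₁)) (Kv (E₂ \ s₂)))) *
            (g (K s₁) - g (gl (K (E₁ \ s₁)) (Kv (E₂ \ s₂)))) else 0) := by
        simp only [hI]
        refine Finset.sum_congr rfl fun s₁ _ => ?_
        by_cases h1 : v ∈ K s₁
        · rw [if_neg (fun h => h.1 ⟨h1, hz1⟩), if_neg (fun h => h h1)]
        · rw [if_pos ⟨fun h => h1 h.1, fun h => hz2 h.2⟩, if_pos h1, gl_of_not _ _ h1]
      rw [hIs]; exact blockB _
    · -- (0,1)
      have hIs : I s₂ = ∑ s₁ ∈ E₁.powerset, (if v ∉ K (E₁ \ s₁)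
          then (f (gl (K s₁) (Kv s₂)) - f (K (E₁ \ s₁))) * (g (gl (K s₁) (Kv s₂)) - g (K (E₁ \ s₁))) else 0) := by
        simp only [hI]
        refine Finset.sum_congr rfl fun s₁ _ => ?_
        by_cases h2 : v ∈ K (E₁ \ s₁)
        · rw [if_neg (fun h => h.2 ⟨h2, hz2⟩), if_neg (fun h => h h2)]
        · rw [if_pos ⟨fun h => hz1 h.2, fun h => h2 h.1⟩, if_pos h2, gl_of_not _ _ h2]
      rw [hIs]; exact blockC _
    · exact absurd ⟨hz1, hz2⟩ hnot

open Classical in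
/-- **THEOREM SP (b) — series composition** (memo `prim-lf-2/CW-MARTINGALE-gen25.md` §8), plain form: under the gluing hypotheses of `cwpa_series_core`,
`(E₁; x, v) ∈ 𝒞` and `(E₂; v, z) ∈ 𝒞` imply `(E₁ ∪ E₂; x, z) ∈ 𝒞`.  [cite: KozmaNitzan2024, Questions 8–9 (§5.5 p. 36) (context)] -/
theorem cwpa_series (ends : ι → Sym2 V) {E₁ E₂ : Finset ι} (hE : Disjoint E₁ E₂) {x v z : V}
    (hsep : ∀ e ∈ E₁, ∀ e' ∈ E₂, ∀ w : V, w ∈ ends e → w ∈ ends e' → w = v)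
    (hx : ∀ e ∈ E₂, x ∉ ends e) (hz : ∀ e ∈ E₁, z ∉ ends e) (hzx : z ≠ x)
    (h₁ : ∀ φ ψ : Set V → ℝ, Monotone φ → Monotone ψ →
      0 ≤ ∑ s ∈ E₁.powerset.filter (fun s : Finset ι => v ∉ openCluster (ends '' (↑s : Set ι)) x ∧
            v ∉ openCluster (ends '' (↑(E₁ \ s) : Set ι)) x),
        (φ (openCluster (ends '' (↑s : Set ι)) x) - φ (openCluster (ends '' (↑(E₁ \ s) : Set ι)) x)) *
          (ψ (openCluster (ends '' (↑s : Set ι)) x) - ψ (openCluster (ends '' (↑(E₁ \ s) : Set ι)) x)))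
    (h₂ : ∀ φ ψ : Set V → ℝ, Monotone φ → Monotone ψ →
      0 ≤ ∑ s ∈ E₂.powerset.filter (fun s : Finset ι => z ∉ openCluster (ends '' (↑s : Set ι)) v ∧
            z ∉ openCluster (ends '' (↑(E₂ \ s) : Set ι)) v),
        (φ (openCluster (ends '' (↑s : Set ι)) v) - φ (openCluster (ends '' (↑(E₂ \ s) : Set ι)) v)) *
          (ψ (openCluster (ends '' (↑s : Set ι)) v) - ψ (openCluster (ends '' (↑(E₂ \ s) : Set ι)) v)))
    (f g : Set V → ℝ) (hf : Monotone f) (hg : Monotone g) :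
    0 ≤ ∑ s ∈ (E₁ ∪ E₂).powerset.filter (fun s : Finset ι => z ∉ openCluster (ends '' (↑s : Set ι)) x ∧
          z ∉ openCluster (ends '' (↑((E₁ ∪ E₂) \ s) : Set ι)) x),
      (f (openCluster (ends '' (↑s : Set ι)) x) - f (openCluster (ends '' (↑((E₁ ∪ E₂) \ s) : Set ι)) x)) *
        (g (openCluster (ends '' (↑s : Set ι)) x) - g (openCluster (ends '' (↑((E₁ ∪ E₂) \ s) : Set ι)) x)) :=
  cwpa_series_core ends hE hsep hx hz hzx (fun _ => h₁) h₂ f g hf hg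

open Classical in
/-- **Series composition when the `z`-side piece has no doubly connected colouring** (memo §8, remark after the proof of (b)): if no colouring of `E₂`
connects `v` to `z` in BOTH colours (e.g. `E₂` a single edge `v–z`, a hanging path, or any piece in which some single edge separates `v` from `z`), the block
`(1,1)` is empty and NO hypothesis on `(E₁; x, v)` is needed: `(E₂; v, z) ∈ 𝒞` alone gives `(E₁ ∪ E₂; x, z) ∈ 𝒞` for an ARBITRARY piece `E₁`.  With `E₂` a
single pendant edge this is gen 23's theorem `cwpa_pendant_symm` again.  [cite: KozmaNitzan2024, Questions 8–9 (§5.5 p. 36) (context)] -/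
theorem cwpa_series_of_noDoublePath (ends : ι → Sym2 V) {E₁ E₂ : Finset ι} (hE : Disjoint E₁ E₂) {x v z : V}
    (hsep : ∀ e ∈ E₁, ∀ e' ∈ E₂, ∀ w : V, w ∈ ends e → w ∈ ends e' → w = v)
    (hx : ∀ e ∈ E₂, x ∉ ends e) (hz : ∀ e ∈ E₁, z ∉ ends e) (hzx : z ≠ x)
    (hcut : ∀ s₂, s₂ ⊆ E₂ → z ∈ openCluster (ends '' (↑s₂ : Set ι)) v → z ∉ openCluster (ends '' (↑(E₂ \ s₂) : Set ι)) v)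
    (h₂ : ∀ φ ψ : Set V → ℝ, Monotone φ → Monotone ψ →
      0 ≤ ∑ s ∈ E₂.powerset.filter (fun s : Finset ι => z ∉ openCluster (ends '' (↑s : Set ι)) v ∧
            z ∉ openCluster (ends '' (↑(E₂ \ s) : Set ι)) v),
        (φ (openCluster (ends '' (↑s : Set ι)) v) - φ (openCluster (ends '' (↑(E₂ \ s) : Set ι)) v)) *
          (ψ (openCluster (ends '' (↑s : Set ι)) v) - ψ (openCluster (ends '' (↑(E₂ \ s) : Set ι)) v)))
    (f g : Set V → ℝ) (hf : Monotone f) (hg : Monotone g) :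
    0 ≤ ∑ s ∈ (E₁ ∪ E₂).powerset.filter (fun s : Finset ι => z ∉ openCluster (ends '' (↑s : Set ι)) x ∧
          z ∉ openCluster (ends '' (↑((E₁ ∪ E₂) \ s) : Set ι)) x),
      (f (openCluster (ends '' (↑s : Set ι)) x) - f (openCluster (ends '' (↑((E₁ ∪ E₂) \ s) : Set ι)) x)) *
        (g (openCluster (ends '' (↑s : Set ι)) x) - g (openCluster (ends '' (↑((E₁ ∪ E₂) \ s) : Set ι)) x)) :=
  cwpa_series_core ends hE hsep hx hz hzx (fun ⟨s₂, hs₂, hz1, hz2⟩ => absurd hz2 (hcut s₂ hs₂ hz1)) h₂ f g hf hg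

end Coefficientwise

end Summit.CriticalPhenomena.PercolationContinuityZ3.Theorems
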